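import Summits.BirchSwinnertonDyer.BirchSwinnertonDyer.Theses.KolyvaginRankRigidityAtTwo
import Summits.BirchSwinnertonDyer.BirchSwinnertonDyer.Theorems.Rank1ResidualJetRingClassFields
import Summits.BirchSwinnertonDyer.BirchSwinnertonDyer.Theorems.ByReductionTypeAtTwoRankOneAtTwoOffBigImageOddLocalEngineEndToEnd
import Literature.NumberTheory.EllipticCurves.Jetchev2008.CoreVertices
import Summits.BirchSwinnertonDyer.BirchSwinnertonDyer.Theorems.KolyvaginRankRigidityAtTwoRegularCoreSupplyAtTwoRegularConductors
import Summits.BirchSwinnertonDyer.BirchSwinnertonDyer.Theorems.KolyvaginRankRigidityAtTwoWalkNearCore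
import Summits.BirchSwinnertonDyer.BirchSwinnertonDyer.Theorems.KolyvaginRankRigidityAtTwoStartFrameOfParity
import Summits.BirchSwinnertonDyer.BirchSwinnertonDyer.Theorems.KolyvaginRankRigidityAtTwoStartFrameNearCoreHolds
import Summits.BirchSwinnertonDyer.BirchSwinnertonDyer.Theorems.GenusKolyvaginAtTwoKolyvaginRelationAtTwo
import HarnessLib
import Summits.BirchSwinnertonDyer.BirchSwinnertonDyer.Theorems.GenusKolyvaginAtTwoPowDvdShaCardAtTwoRTKolyvaginClassOrder
import Summits.BirchSwinnertonDyer.BirchSwinnertonDyer.Theorems.KolyvaginRoadThreeLevelData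
import Summits.BirchSwinnertonDyer.Rank1Residual.X11b.Three.KolyvaginNonvanishing
import Literature.NumberTheory.EllipticCurves.HeegnerPointsOfConductorRationalityProofs
import Literature.NumberTheory.EllipticCurves.RingClassGalOverCyclicProofs

set_option linter.dupNamespace false

/-!
# LINE 17 v7.2r (REGISTRABLE: single crux-concluding theorem) `kolyvagin_swap` (v7.1 with the swap GENERALISED: shed one seed prime per BLOCK of `B+1` engine primes; §4–§5) — crux U1 `KolyvaginBoundedDefectAtTwo` (stmt-BirchSwinnertonDyer-28083)
# of route `KolyvaginRankRigidityAtTwo` (KRR); ideator seat `bsd-idea-1` (D-0145, gen 14; technique card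
# «compactness–contradiction / RIGIDITY»; director focus: beyond-print theorems at the prime 2).

TARGET BY NAME: `Summit.BirchSwinnertonDyer.BirchSwinnertonDyer.Theses.KolyvaginRankRigidityAtTwo.KolyvaginBoundedDefectAtTwo`.
No summit, no rung and no crux is proved by this file; BSD is NOT proved; U1 is NOT proved.

## Why v7 (2026-08-29, pen g14) — THE FREENESS SUBSTITUTE IS KOLYVAGIN'S OWN PRIME SWAP
The registered line of record v6 (`regular_core_rigidity_v6.lean`, sha 2a399f69403a) reduces U1 to {S0 input, P17 print, S2♭
`HorizontalCoreRigidityAtTwo`}, and the critic (#282) prices S2♭ as XL / research-grade: Mazur–Rubin / Howard freeness of the Kolyvagin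
system over `ℤ/2^L`, whose hypotheses (H.3)/(H.5) FAIL at 2 — «0 prover hands until a planner names the freeness substitute».
v7 NAMES it, from print: Kolyvagin never used freeness.  In *On the structure of Selmer groups* (Math. Ann. 291 (1991); held:
`paper:doi-10-1007-bf01445205`), proof of Thm. 2.2 (PDF p. 6): «Let η₁′ = p₀p₁′…p_f′ ∈ Λ^f_{m_f+1} be such that m(η₁′) = m_f.  By means of
[1, Proposition 8] we can, by induction, REPLACE p₁′, …, p_f′ by p₁, …, p_f such that η₁ = p₀…p_f ∈ Λ^f_{n₀} and m(η₁) = m_f» — the shallow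
primes of a seed conductor are SWAPPED one at a time for primes as deep as desired, keeping the divisibility exponent; and after Conj. 2.5
(PDF p. 8), for an ARBITRARY prime `ℓ` (so `ℓ = 2`, «with a natural modification for ℓ ∉ B(E)», p. 9): «there exists k(r) ≥ k₀ such that the
condition (2.1) [= strong nonzero system = our parent crux `KolyvaginStrongNonzeroSystemAtTwo`] is equivalent to the condition that
∃ n, V^r_{n,k(r)} ≠ 0» — a ROOM-SEED at relative depth `k(r)` gives the strong system.  [1] = Kolyvagin, *On the structure of
Shafarevich–Tate groups*, LNM 1479 (1991) 94–121 (`Kolyvagin1991StructureSha`; not held, acq-08093).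

## The swap at 2 (blueprint of the load-bearing stub `stub_seedPrimeSwapAtTwo`)
State: a Kolyvagin conductor `n = s·e` (seed part `s`, engine part `e` = regular Kolyvagin primes of index `≥ I` chosen by us), a level
`M ≤ M(n)`, a Kolyvagin–Heegner datum `d` with class `c = c_M(n)` of VISIBLE order `> 2^{v+κ}` (visible = after restriction to
`Γ_{K(E[2^M])}`, i.e. some `[c, ρ] = h1Eval c ρ ≠ 0`-multiple survives; the invisible part is the ONE-BIT phantom line
`H¹(K(E[2^M])/K, E[2^M]) ≤ ℤ/2`, K1⁺ `PhantomLineAtTwo`, landing by krr2-p2 g17), and a FRAME at the engine part: a class `x ∈ H_{𝓕(e)}(K, E[2^M])`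
(`Jetchev2008.modifiedSelmerGroup W K ι 2^M e`: Kummer condition off `e`, transverse at `e`) of exact order `2^M` (at `e = 1` this is the
tree theorem `RegularWalk.startFrameAtTwo_holds`, unconditional since Monsky's parity landed).  STEP: choose by the in-tree regular value
engine `RegularValueEngine.exists_regular_kolyvaginPrime_values_of_heegner` a regular Kolyvagin prime `ℓ ∤ n` of index `≥ I` whose Frobenius
`ρ ∈ Γ_{K(E[2^M])}` gives `loc_λ c = [c, ρ]` and `loc_λ x = [x, ρ]` their full visible orders and aligned under the local Tate pairing, so that
`B := ⟨φ_ℓ(loc^f_λ c), loc^f_λ x⟩_λ` has order `> 2^v` (`φ_ℓ : H¹_f(K_λ) → H¹_s(K_λ)` the finite-to-singular map; the engine also serves the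
parity lift of `((ℓ+1) ± a_ℓ)/2^M` that makes `φ_ℓ` injective on the line of `loc c`, and keeps a frame at `e·ℓ`).  By the UP relation
(Kolyvagin [1, Prop. 1]/Gross Prop. 6.2(2); the tree's Q2♭↑ reading `KolyvaginTransferUpAtTwo`) `loc^s_λ c_M(nℓ) = φ_ℓ(loc^f_λ c)`.  POITOU–TATE
for the pair `(c_M(nℓ), x)`: `Σ_w inv_w(c_M(nℓ) ∪ x) = 0`; the terms vanish at the primes of `e` (both classes transverse — a Lagrangian), off
`nℓ·N·2·∞` (both unramified), at `∞` (complex place) and — up to a BOUNDED index absorbed in `κ` (component groups at `v ∣ N`, `E(K_v)[2^∞]`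
at `v ∣ 2`) — at `v ∣ 2N`; what is left is `B + Σ_{q ∣ s} ⟨loc^s_q c_M(nℓ), loc^f_q x⟩ = 0`.  Hence SOME seed prime `q ∣ s` has
`loc^s_q c_M(nℓ)` of order `> 2^v`, and by the DOWN reading of the same relation at `q` (`loc^s_q c_M(nℓ) = φ_q(loc^f_q c_M(nℓ/q))`, `φ_q` a
homomorphism — no invertibility needed in this direction) `loc^f_q c_M(nℓ/q) = [c_M(nℓ/q), Frob_q]` has order `> 2^v`: the class at the
conductor `nℓ/q = (s/q)·(eℓ)` — ONE SEED PRIME FEWER, same depth, same level — is visibly of order `> 2^v`.  Iterating `#s` times (kernel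
below: induction on the number of seed primes, room budget `κ` per step) reaches a conductor made of engine primes only, of index `≥ I`, with
`c_{M}(·) ≠ 0` at the FIXED seed level: that is `DeepSeedAtTwo`, and `DeepSeedAtTwo → U1` is the v6 kernel theorem (vertical growth,
McCallum 4.5 at 2, PROVED, §2–§3 below verbatim from v6).

v7.1 (§5) CUTS SW: SW ⟸ SWα `ShedSeedPrimeAtTwo` (reciprocity shedding, NEW, L) + Q2 at 2 = GK2 item 24880 BY NAME
(tree theorem modulo the PRINT fact `GrossLMS1991.prop37_2_frobeniusCongruence`, p614530) + EV `SingularToVisibleAtTwo` (routine, S); stubs of v7.1 =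
{S0ʳ input, SWα, P372 print, EV routine} — sorry count 4, zero elsewhere.  (v7 proper:) REGISTERED-SHAPE STUBS v7 = {S0ʳ `stub_roomSeedAtTwo` (INPUT: Kolyvagin's conjecture at 2 in Kolyvagin's own k(r)-form — classes of
UNBOUNDED visible order at one depth), SW `stub_seedPrimeSwapAtTwo` (THE theorem of the line, L: the reciprocity swap at 2 on engine primes)}
— sorry count 2, zero elsewhere; the start frame is the tree theorem BY NAME (`startLineAtTwo_holds`, no sorry);
`KolyvaginBoundedDefectAtTwo_of_stubs ⊢ U1` BY NAME.  S0ʳ sits between the S0 cell's frame `KolyvaginNonvanishingAtTwoFrame` (24622: one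
non-zero class) and U1 (U1 ⟹ S0ʳ given K1⁺; S0ʳ ⟹ 24622 trivially); the gap 24622 ↛ S0ʳ is the honest residue of «weak ⟹ strong» at 2
(a seed that IS the phantom, or has no room, cannot be swapped) and is exactly Kolyvagin's k(r).  NOT a costume: SW is a local-to-the-seed
statement (any visibly roomy class at any (n, M) can shed a seed prime), not a reading of U1; S0ʳ alone gives no deep conductor at a fixed level.
Why SW might fail (for the card): (a) ALIGNMENT — if `c_M(n)` and the frame class `x` are visibly DEPENDENT mod 2 the engine cannot make `B ≠ 0`
(reciprocity then forces `B = 0`); the prover must re-frame (`x ↦ x + y`) or detour through one UP step; (b) the bad-prime terms at `v ∣ 2N` must be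
bounded uniformly in `M` (Kummer images vs unramified classes: component groups, bounded); (c) frame propagation `e ↦ eℓ` jointly with the value
prescription (the tree's RegularWalk step does each separately).  NOT registered by the pen (W-79); v6 stays the line of record until the
director / critic rule.  BSD is NOT proved; U1 is NOT proved (S0ʳ, SW open).

## v7.2 (pen g14, ~09:50Z) — SIGN-LINE ISOTROPY and the NEAR-CORE SQUEEZE (why the swap now adds a BLOCK of engine primes)
Self-audit of SWα's blueprint found the precise form of risk (a): at a regular prime `λ` (Frobenius `h`, `h² = 1`, `E[2^M]` free of rank one
over `ℤ/2^M[h]`) the two lines `N_± = (1 ± h)E[2^M] ≅ ℤ/2^M` are each ISOTROPIC for the local Tate (Weil) pairing and `e(N_+, N_−) = 2·(perfect)`;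
the localisation of a class `c` with `c^{τ} = ε c` at any admissible `λ` lies in (an offset inside) `N_ε`, and `φ_ℓ` preserves `N_ε`.  Hence the
reciprocity term `B = ⟨φ_ℓ loc_λ c_M(n), loc_λ x⟩` VANISHES IDENTICALLY whenever the partner `x` is visibly of the seed's sign `ε_n` — exactly
Kolyvagin's sign alternation (p odd: `E⁺ ⊥ E⁺`), which survives at 2 as line-isotropy.  A partner of the opposite line need not exist in
`H_{𝓕(e)}` (e.g. Ш[2^∞] small, rank one, seed of the wrong parity).  REPAIR = Kolyvagin's own freedom to insert primes BEFORE removing one: the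
swap step may first take `t ≤ B` UP steps `n ↦ nℓ₁⋯ℓ_t` (aligned engine values keep the class big: Q2-up, tree) that (i) make `H_{𝓕(eℓ₁⋯ℓ_t)}`
NEAR-CORE (`2^κ H ⊆ ℤx'`, the tree's S1b mechanism `RegularWalk.nearCoreExistenceAtTwo_holds`) and (ii) flip the class sign `ε ↦ −ε` once if
needed; then the NEAR-CORE SQUEEZE: `x'` is `τ`-eigen up to `2^κ` (automatic for a near-cyclic `τ`-stable group: `u² ≡ 1`) with some sign `u`, the
prolonged class `c'` has sign `−u`, so if ALL seed-prime singular parts of `c'` were `≤ 2^v` then `2^{v+b} c' ∈ H_{𝓕(e')}` would be a big class of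
sign `−u` inside `ℤx' + (2^κ-torsion)` of sign `u`, forcing `2·2^κ·2^{v+b} c' = 0` — contradiction with the room.  So SOME seed prime `q` carries a
singular part of `c'` of order `> 2^v`, and the DOWN reading (Q2 + EV, §5) sheds it.  No partner and no Poitou–Tate sum is needed on this branch
(reciprocity with an opposite-line partner remains plan B).  Consequently SW / SWα are RE-TYPED (v7.2): one shed = remove ONE seed prime and add
a block `f` of exactly `B+1` new regular engine primes of index `≥ I` (`B` uniform, chosen by the prover together with `κ`; `B = 0` is v7.1's
statement, so v7.2's SW/SWα are WEAKER than v7.1's); the kernel `walk` carries the invariant `#primes(n) + B·#primes(s) = r(1+B)` and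
`DeepSeedAtTwo` gets depth `r + B·r`.  Sorry count unchanged (4: S0ʳ, SWα, P372, EV).  BC7 re-probed for the re-typed SW/SWα.
-/
namespace Summit.BirchSwinnertonDyer.BirchSwinnertonDyer.Cruxes.KolyvaginBoundedDefectAtTwo.KolyvaginSwap.Vertical

open scoped Classical
open WeierstrassCurve NumberField Field
open Literature.NumberTheory.GaloisRepresentations Literature.NumberTheory.EllipticCurves Literature.NumberTheory
open Literature.NumberTheory.EllipticCurves.ModularForms Literature.NumberTheory.EllipticCurves.KolyvaginCocycle
open Summit.BirchSwinnertonDyer.Rank1Residual.X11b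
open Summit.BirchSwinnertonDyer.BirchSwinnertonDyer.Theorems
open Summit.BirchSwinnertonDyer.BirchSwinnertonDyer.Theorems.GenusExact.PlusDescent
open Summit.BirchSwinnertonDyer.BirchSwinnertonDyer.Theses.KolyvaginRankRigidityAtTwo

/-! ## §1 `P(n) ∉ 2^{M₁} E(K[n]) ⟹ 2^j · c_M(n) ≠ 0` for `j + M₁ ≤ M` -/

section Family

variable {W : WeierstrassCurve ℚ} [NeZero (W.conductorNorm ℤ)] {K : Type} [Field K] [NumberField K]
  {Dt : ModularParametrizationData W (W.conductorNorm ℤ)} {β : ℤ} {ι : K →+* ℂ}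

/-- **`2^j·c_M(n) ≠ 0` for `j + M₁ ≤ M` when `P(n) ∉ 2^{M₁}E(K[n])`** on U1's frame (GK2's `pow_zsmul_kolyvaginClass_two_ne_zero` with
`2` replaced by `2^{M₁}`): `2^j·c_M(n) = c_M(2^j P(n))` vanishes iff `2^j P(n) = 2^M B` with `B ∈ E(K[n])` (McCallum Cor. 4.5), and then
`2^j (2^{M−j} B − P(n)) = 0` with `E(K[n])[2^∞] = 0` gives `P(n) = 2^{M₁}·(2^{M−j−M₁} B)`.
[cite: McCallumLMS1991, §4 Cor. 4.5] [cite: GrossLMS1991, Prop. 4.7 (1) and Lemma 4.3] -/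
theorem pow_zsmul_kolyvaginClass_two_ne_zero_of_not_pDiv [W.IsElliptic] [W.IsGloballyMinimal] (hK : IsImaginaryQuadratic K)
    (hodd : Odd (NumberField.discr K)) (h3 : NumberField.discr K ≠ -3)
    (hH : SatisfiesHeegnerHypothesis (W.conductorNorm ℤ) K) (hsurj : W.HasSurjectiveModNGaloisRep ((2 : ℤ) ^ 1))
    {n M : ℕ} (hn : Squarefree n)
    (hkol : ∀ q ∈ n.primeFactors,
      Zhang2014.IsKolyvaginPrime (W.conductorNorm ℤ) W K 2 q ∧ M ≤ Zhang2014.kolyvaginIndex W 2 q)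
    (d : (m : ℕ) → m ∣ n → KolyvaginHeegnerData Dt β ι m) {M₁ : ℕ}
    (hprim : ¬ Three.Koly.PDiv (d n dvd_rfl) 2 M₁) {j : ℕ} (hj : j + M₁ ≤ M) :
    (((2 ^ j : ℕ) : ℤ)) • (d n dvd_rfl).kolyvaginClass Nat.prime_two M ≠ 0 := by
  have hA := GenusKoly.isAdmissible_pointsSubgroup_two hK hodd hH hsurj hn.ne_zero (d n dvd_rfl) M
  have hP := Three.KolyCert.toGeomPoints_derivedPoint_mem_invPoints_of_dvd_zhang hK ι Dt Nat.prime_two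
    (GenusKoly.heegner_isCoprime_conductorNorm_discr hK hH) (GenusKoly.discr_lt_neg_four_of_odd hK hodd h3) hn hkol d n
    dvd_rfl
  set dn := d n dvd_rfl with hdn
  rw [dn.kolyvaginClass_of_admissible Nat.prime_two M hA hP, ← kolyvaginClass_zsmul]
  have hpt : (((2 ^ j : ℕ) : ℤ)) • dn.toGeomPoints dn.derivedPoint =
      dn.toGeomPoints ((((2 ^ j : ℕ) : ℤ)) • dn.derivedPoint) := (map_zsmul _ _ _).symm
  rw [KolyvaginDescent.kolyvaginClass_congr_point hA
      (hP' := by rw [← hpt]; exact AddSubgroup.zsmul_mem _ hP _) hpt]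
  intro h0
  obtain ⟨_, ⟨B, rfl⟩, hB⟩ := (kolyvaginClass_eq_zero_iff hA _
      (N := {g : absoluteGaloisGroup K | ∀ x : ringClassField K ι n,
        (show AlgebraicClosure K ≃ₐ[K] AlgebraicClosure K from g) (dn.emb x) = dn.emb x})
      (fun g hg ↦ Three.KolyCert.smul_toGeomPoints_of_forall_emb dn g hg _)
      (fun v hv ↦ Three.KolyCert.mem_pointsSubgroup_of_forall_smul_eq dn v fun g hg ↦ hv g hg)).mp h0
  -- `2^M • B = 2^j • P(n)` in `E(K[n])`
  have hB' : (((2 ^ M : ℕ) : ℤ)) • B = (((2 ^ j : ℕ) : ℤ)) • dn.derivedPoint := by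
    apply Affine.Point.map_injective (W' := W) dn.emb.toRatAlgHom
    change dn.toGeomPoints ((((2 ^ M : ℕ) : ℤ)) • B) = dn.toGeomPoints ((((2 ^ j : ℕ) : ℤ)) • dn.derivedPoint)
    rw [map_zsmul]
    exact hB
  obtain ⟨e, he⟩ := Nat.exists_eq_add_of_le hj
  -- `2^j • (2^{M₁+e} • B − P(n)) = 0`, hence `P(n) = 2^{M₁} • (2^e • B)`
  have hzero : (((2 ^ j : ℕ) : ℤ)) • ((((2 ^ (M₁ + e) : ℕ) : ℤ)) • B - dn.derivedPoint) = 0 := by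
    rw [zsmul_sub, smul_smul, ← hB', he]
    push_cast
    ring_nf
    simp
  have hfree := GenusKoly.heegner_two_pow_torsion_free (ι := ι) hK hodd hH hsurj hn.ne_zero j _ hzero
  rw [sub_eq_zero] at hfree
  apply hprim
  refine ⟨(((2 ^ e : ℕ) : ℤ)) • B, ?_⟩
  rw [smul_smul, ← hfree]
  push_cast
  ring_nf

/-- **Vertical growth, family form**: `c_{M₁}(n) ≠ 0 ∧ M₁ ≤ M ≤ M(n) ⟹ 2^{M−M₁} · c_M(n) ≠ 0`. [cite: McCallumLMS1991, §4 Cor. 4.5, Lemma 4.6] -/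
theorem two_pow_sub_zsmul_kolyvaginClass_two_ne_zero [W.IsElliptic] [W.IsGloballyMinimal] (hK : IsImaginaryQuadratic K)
    (hodd : Odd (NumberField.discr K)) (h3 : NumberField.discr K ≠ -3)
    (hH : SatisfiesHeegnerHypothesis (W.conductorNorm ℤ) K) (hsurj : W.HasSurjectiveModNGaloisRep ((2 : ℤ) ^ 1))
    {n M : ℕ} (hn : Squarefree n)
    (hkol : ∀ q ∈ n.primeFactors,
      Zhang2014.IsKolyvaginPrime (W.conductorNorm ℤ) W K 2 q ∧ M ≤ Zhang2014.kolyvaginIndex W 2 q)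
    (d : (m : ℕ) → m ∣ n → KolyvaginHeegnerData Dt β ι m) {M₁ : ℕ}
    (hseed : (d n dvd_rfl).kolyvaginClass Nat.prime_two M₁ ≠ 0) (hM₁ : M₁ ≤ M) :
    (((2 ^ (M - M₁) : ℕ) : ℤ)) • (d n dvd_rfl).kolyvaginClass Nat.prime_two M ≠ 0 :=
  pow_zsmul_kolyvaginClass_two_ne_zero_of_not_pDiv hK hodd h3 hH hsurj hn hkol d
    (Three.Koly.not_pDiv_of_kolyvaginClass_ne_zero _ hseed) (by omega)

end Family

/-! ## §2 VERTICAL GROWTH in U1's single-datum currency — PROVED -/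

/-- VG · VERTICAL GROWTH AT 2 (U1's frame and currency, one Kolyvagin–Heegner datum `d` at `n`): a non-zero class at ONE level `M₁`
forces `2^{M−M₁}·c_M(n) ≠ 0` at every level `M₁ ≤ M ≤ M(n)` (order `≥ 2^{M−M₁+1}`, defect `≤ M₁ − 1`).  PROVED below
(`verticalGrowthAtTwo_holds`); stated as a `def` so that skeletons can take it BY NAME. [cite: McCallumLMS1991, §4 Cor. 4.5, Lemma 4.6] -/
def VerticalGrowthAtTwo : Prop :=
  ∀ (W : WeierstrassCurve ℚ) [W.IsElliptic] [W.IsGloballyMinimal], (∀ m : ℕ, W.HasSurjectiveModNGaloisRep (2 ^ m : ℕ)) →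
    ∀ (K : Type) [Field K] [NumberField K], IsImaginaryQuadratic K → ∀ [NeZero (W.conductorNorm ℤ)],
    SatisfiesHeegnerHypothesis (W.conductorNorm ℤ) K → Odd (NumberField.discr K) → NumberField.discr K ≠ -3 →
    ∀ (Dt : ModularParametrizationData W (W.conductorNorm ℤ)) (β : ℤ) (ι : K →+* ℂ) (n : ℕ) (d : KolyvaginHeegnerData Dt β ι n)
      (M₁ M : ℕ), KolyvaginDescent.KolSupp (Zhang2014.IsKolyvaginPrime (W.conductorNorm ℤ) W K 2) n →
      ((M : ℕ) : ℕ∞) ≤ Zhang2014.levelIndex W 2 n → M₁ ≤ M → d.kolyvaginClass Nat.prime_two M₁ ≠ 0 →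
      (2 ^ (M - M₁) : ℤ) • d.kolyvaginClass Nat.prime_two M ≠ 0

/-- **VG holds** (sorry-free): data at the divisors of `n` from Gross's two CM facts (both PROVED in Literature:
`phi_heegnerPointOfConductor_mem_range_map_ringClassField_holds`, `exists_generator_ringClassGalOver_holds`) via
`nonempty_kolyvaginHeegnerData_of_grossCM`, patched to the given `d` at `n`; then §1.
[cite: McCallumLMS1991, §4 Cor. 4.5] [cite: GrossLMS1991, §3–§4] -/
theorem verticalGrowthAtTwo_holds : VerticalGrowthAtTwo := by
  intro W _ _ hsurj K _ _ hK _ hH hodd h3 Dt β ι n d M₁ M hKol hidx hM₁ hseed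
  have hsurj1 : W.HasSurjectiveModNGaloisRep ((2 : ℤ) ^ 1) := by simpa using hsurj 1
  have hn : Squarefree n := hKol.1
  have hkol : ∀ q ∈ n.primeFactors,
      Zhang2014.IsKolyvaginPrime (W.conductorNorm ℤ) W K 2 q ∧ M ≤ Zhang2014.kolyvaginIndex W 2 q :=
    fun q hq ↦ ⟨hKol.2 q hq, Zhang2014.natCast_le_levelIndex_iff.mp hidx q hq⟩
  have hinert : ∀ q ∈ n.primeFactors, (Ideal.span {(q : 𝓞 K)}).IsPrime := fun q hq ↦ (hKol.2 q hq).2.2.2.2.1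
  have hCM1 : phi_heegnerPointOfConductor_mem_range_map_ringClassField (W.conductorNorm ℤ) W K :=
    phi_heegnerPointOfConductor_mem_range_map_ringClassField_holds (W.conductorNorm ℤ) W K
  have hCM2 : exists_generator_ringClassGalOver K := exists_generator_ringClassGalOver_holds
  have hne : ∀ m : ℕ, m ∣ n → Nonempty (KolyvaginHeegnerData Dt β ι m) := fun m hm ↦
    nonempty_kolyvaginHeegnerData_of_grossCM hCM1 hCM2 hK hH Dt β ι d.dvd_sq_sub (hn.squarefree_of_dvd hm)
      (fun q hq ↦ hinert q (Nat.primeFactors_mono hm hn.ne_zero hq))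
  let data : (m : ℕ) → m ∣ n → KolyvaginHeegnerData Dt β ι m := fun m hm ↦
    if h : m = n then h ▸ d else (hne m hm).some
  have hdata : data n dvd_rfl = d := by simp [data]
  have h := two_pow_sub_zsmul_kolyvaginClass_two_ne_zero hK hodd h3 hH hsurj1 hn hkol data (M₁ := M₁)
    (by rw [hdata]; exact hseed) hM₁
  rw [hdata] at h
  simpa only [Nat.cast_pow, Nat.cast_ofNat] using h

/-! ## §3 DEEP SEED ⟹ U1 (kernel-checked reading of the crux) -/

/-- S0⁺ · DEEP SEED AT 2 — Kolyvagin's conjecture at 2 in DEEP FIXED-LEVEL form on U1's habitat and frame: a depth `r` and ONE level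
`M₁ ≥ 1` such that for every `M* ≥ M₁` some square-free Kolyvagin conductor `n` with exactly `r` prime factors, all of Kolyvagin index
`≥ M*`, carries a Kolyvagin–Heegner datum with `c_{M₁}(n) ≠ 0`.  Beyond print at 2 (W. Zhang 2014 / BCGS are `p` odd; at `p ≥ 5` it is
what Zhang's theorem gives at the core vertices of `Sel_p(E/K)`, which exist at every index).  Implies U1 (next theorem) and is implied
by U1 (level reduction) — so it is a READING of the crux, not a weakening.  Why it might fail: only with Kolyvagin's conjecture at 2 itself.
[cite: Kolyvagin1991StructureSha] [cite: WZhang2014, Thm. 1.1] -/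
def DeepSeedAtTwo : Prop :=
  ∀ (W : WeierstrassCurve ℚ) [W.IsElliptic] [W.IsGloballyMinimal], ¬ W.HasCM →
    (Literature.NumberTheory.EllipticCurves.Rank1Residual.GoodOrd W 2 ∨ Literature.NumberTheory.EllipticCurves.Rank1Residual.Mult W 2) →
    (∀ m : ℕ, W.HasSurjectiveModNGaloisRep (2 ^ m : ℕ)) → ∀ (K : Type) [Field K] [NumberField K],
    IsImaginaryQuadratic K → ∀ [NeZero (W.conductorNorm ℤ)], SatisfiesHeegnerHypothesis (W.conductorNorm ℤ) K →
    Odd (NumberField.discr K) → NumberField.discr K ≠ -3 → AddSubgroup.torsionBy (W.baseChange K).toAffine.Point (2 : ℤ) = ⊥ →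
    SatisfiesHeegnerHypothesis 2 K →
    ∀ (Dt : ModularParametrizationData W (W.conductorNorm ℤ)) (β : ℤ) (ι : K →+* ℂ),
      (4 * (W.conductorNorm ℤ : ℤ)) ∣ β ^ 2 - NumberField.discr K →
      ∃ r M₁ : ℕ, 1 ≤ M₁ ∧ ∀ Mstar : ℕ, M₁ ≤ Mstar →
        ∃ (n : ℕ) (d : KolyvaginHeegnerData Dt β ι n),
          KolyvaginDescent.KolSupp (Zhang2014.IsKolyvaginPrime (W.conductorNorm ℤ) W K 2) n ∧ n.primeFactors.card = r ∧
          ((Mstar : ℕ) : ℕ∞) ≤ Zhang2014.levelIndex W 2 n ∧ d.kolyvaginClass Nat.prime_two M₁ ≠ 0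

/-- **DEEP SEED ⟹ U1** (sorry-free; `r := r`, `m := M₁ − 1`, the vertex for level `M` is the deep seed's vertex at `M* := M`, and the
order bound is VERTICAL GROWTH §2).  GATE SKELETON RULE (ladder-directors (372), 09:45Z): the crux decl `KolyvaginBoundedDefectAtTwo`
may be the conclusion BY NAME of EXACTLY ONE theorem in the file (`KolyvaginBoundedDefectAtTwo_of_stubs`, zero hypotheses); every intermediate
concludes the ALIAS `CruxAlias` (unfolds to the crux; the gate matches conclusions by name without unfolding). -/
def CruxAlias : Prop := KolyvaginBoundedDefectAtTwo

theorem cruxAlias_iff : CruxAlias ↔ KolyvaginBoundedDefectAtTwo := Iff.rfl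

theorem boundedDefect_of_deepSeed (h : DeepSeedAtTwo) : CruxAlias := by
  show KolyvaginBoundedDefectAtTwo
  intro W _ _ hCM hred hsurj K _ _ hK _ hH hodd hd3 htors hH2 Dt β ι hβ
  obtain ⟨r, M₁, hM₁, hdeep⟩ := h W hCM hred hsurj K hK hH hodd hd3 htors hH2 Dt β ι hβ
  refine ⟨r, M₁ - 1, fun M hM ↦ ?_⟩
  obtain ⟨n, d, hKol, hcard, hidx, hseed⟩ := hdeep M (by omega)
  refine ⟨n, d, hKol, hcard, hidx, ?_⟩
  have hMm : M - (M₁ - 1) - 1 = M - M₁ := by omega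
  rw [hMm]
  exact verticalGrowthAtTwo_holds W hsurj K hK hH hodd hd3 Dt β ι n d M₁ M hKol hidx (by omega) hseed

end Summit.BirchSwinnertonDyer.BirchSwinnertonDyer.Cruxes.KolyvaginBoundedDefectAtTwo.KolyvaginSwap.Vertical

/-! ## §4 (v7) KOLYVAGIN'S PRIME SWAP AT 2: {S0ʳ room seed, SW seed-prime swap} ⟹ DeepSeedAtTwo ⟹ U1 -/

namespace Summit.BirchSwinnertonDyer.BirchSwinnertonDyer.Cruxes.KolyvaginBoundedDefectAtTwo.KolyvaginSwap

open scoped Classical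
open WeierstrassCurve NumberField IsDedekindDomain Field
open Literature.NumberTheory.GaloisRepresentations Literature.NumberTheory.EllipticCurves
open Literature.NumberTheory
open Rat.HeightOneSpectrum
open Summit.BirchSwinnertonDyer.BirchSwinnertonDyer.Theorems
open Summit.BirchSwinnertonDyer.BirchSwinnertonDyer.Theses.KolyvaginRankRigidityAtTwo

/-- S0ʳ · ROOM SEED AT 2 (THE INPUT of the line; Kolyvagin's conjecture at 2 in Kolyvagin's `k(r)`-form).  On U1's habitat and frame:
there is a depth `r` such that for every room `k` some square-free Kolyvagin conductor `n` with exactly `r` prime factors, some level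
`1 ≤ M ≤ M(n)` and some Kolyvagin–Heegner datum `d` have `c_M(n)` of VISIBLE order `> 2^k`: `2^k · [c_M(n), ρ] ≠ 0` for some
`ρ ∈ Γ_{K(E[2^M])}` (`torsionFixing`, `h1Eval` — the tree's Gross §9 pairing).  Between the S0 cell's frame `KolyvaginNonvanishingAtTwoFrame`
(implied: a visible class is non-zero) and U1 (which implies it, given the one-bit phantom line K1⁺); it does NOT by itself put a non-zero
class of a FIXED level on conductors of unbounded index (that is what SW adds).  In print for `ℓ` odd with surjective `ρ̄` this much is what
Zhang 2014 / Kolyvagin's `m_r < ∞` give; at 2 it is beyond print like every form of Kolyvagin's conjecture.  Why it might fail: only with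
Kolyvagin's conjecture at 2 itself, or if all depth-`r` classes at 2 were phantoms / of bounded order (no known mechanism).
[cite: Kolyvagin1991MathAnn, §2 (2.1), Conj. 2.5 and the k(r) remark] [cite: WZhang2014, Thm. 1.1] [cite: GrossLMS1991, §9] -/
def KolyvaginRoomSeedAtTwo : Prop :=
  ∀ (W : WeierstrassCurve ℚ) [W.IsElliptic] [W.IsGloballyMinimal], ¬ W.HasCM → (Literature.NumberTheory.EllipticCurves.Rank1Residual.GoodOrd W 2 ∨ Literature.NumberTheory.EllipticCurves.Rank1Residual.Mult W 2) → (∀ m : ℕ, W.HasSurjectiveModNGaloisRep (2 ^ m : ℕ)) → ∀ (K : Type) [Field K] [NumberField K], Literature.NumberTheory.EllipticCurves.IsImaginaryQuadratic K → ∀ [NeZero (W.conductorNorm ℤ)], Literature.NumberTheory.EllipticCurves.SatisfiesHeegnerHypothesis (W.conductorNorm ℤ) K → Odd (NumberField.discr K) → NumberField.discr K ≠ -3 → AddSubgroup.torsionBy (W.baseChange K).toAffine.Point (2 : ℤ) = ⊥ → Literature.NumberTheory.EllipticCurves.SatisfiesHeegnerHypothesis 2 K → ∀ (Dt : Literature.NumberTheory.EllipticCurves.ModularForms.ModularParametrizationData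 W (W.conductorNorm ℤ)) (β : ℤ) (ι : K →+* ℂ), (4 * (W.conductorNorm ℤ : ℤ)) ∣ β ^ 2 - NumberField.discr K →
    ∃ r : ℕ, ∀ k : ℕ, ∃ (n : ℕ) (d : Literature.NumberTheory.EllipticCurves.KolyvaginHeegnerData Dt β ι n) (M : ℕ),
      Literature.NumberTheory.EllipticCurves.KolyvaginDescent.KolSupp (Literature.NumberTheory.EllipticCurves.Zhang2014.IsKolyvaginPrime (W.conductorNorm ℤ) W K 2) n ∧
      n.primeFactors.card = r ∧ 1 ≤ M ∧ ((M : ℕ) : ℕ∞) ≤ Literature.NumberTheory.EllipticCurves.Zhang2014.levelIndex W 2 n ∧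
      ∃ ρ ∈ torsionFixing (W.baseChange K) ((2 ^ M : ℕ) : ℤ),
        ((2 ^ k : ℕ) : ℤ) • h1Eval (W.baseChange K) ((2 ^ M : ℕ) : ℤ) (d.kolyvaginClass Nat.prime_two M) ρ ≠ 0

/-- SW · SEED-PRIME SWAP AT 2 (THE THEOREM OF THE LINE; Kolyvagin [1, Prop. 8] ported to 2 with the regular value engine).  On U1's
habitat and frame there is a uniform loss `κ` (bits of visible order spent per swap) such that: whenever `n = s·e` is a square-free Kolyvagin
conductor with seed part `s ≠ 1` and engine part `e` all of whose primes have Kolyvagin index `≥ I` and are REGULAR at level `2^M` (the tree's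
regularity clause, inlined as in v6: an arithmetic Frobenius `h` over the prime with `h² = 1` on `E[2^M]` and `2^{M−1}(P + hP) ≠ 0`), `1 ≤ M ≤ I`, `M ≤ M(n)`, the engine part
carries a FRAME (a class of exact order `2^M` in `H_{𝓕(e)}(K, E[2^M])` = `Jetchev2008.modifiedSelmerGroup W K ι 2^M e`), and a
Kolyvagin–Heegner datum `d` at `n` has `c_M(n)` of visible order `> 2^{v+κ}` — then for some seed prime `q ∣ s` (`s = q·s'`) and some BLOCK `f` of
`B+1` NEW REGULAR Kolyvagin primes of index `≥ I` (v7.2; `B` uniform; `B = 0` = one-for-one swap) there is a datum `d'` at `s'·(e·f)` whose class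
`c_M(s'·e f)` has visible order `> 2^v`, and the frame persists at `e·f`.  (The four conductor-bookkeeping conjuncts — `#`prime factors, `KolSupp`, `M ≤ M(s'eℓ)` — are consequences of the rest,
carried so that the kernel induction below stays short.)  Proof blueprint in the file header: engine prime `ℓ` with aligned exact values on
`(c, x)` ⟹ `B = ⟨φ_ℓ loc^f c, loc^f x⟩_λ` of order `> 2^v`; Poitou–Tate for `(c_M(nℓ), x)` kills every term but `B` and the seed primes;
the DOWN relation at the surviving seed prime `q`.  Why it might fail: (a) visible dependence of `c` and the frame class mod 2 forces `B = 0`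
(re-frame or detour); (b) the `v ∣ 2N` terms must be bounded uniformly in `M`; (c) joint Čebotarev (values + frame propagation + parity lift of
`φ_ℓ`).  Honours the Disproof-side record: USES the seed (no seed, no swap), never claims a uniform defect over all conductors, and removes
primes (the up-walk alone — `UpEdgeAtTwo`, proved — cannot leave the seed's shallow primes).
[cite: Kolyvagin1991StructureSha, Prop. 8, Prop. 1] [cite: Kolyvagin1991MathAnn, Thm. 2.2 (proof), §2 after Conj. 2.5]
[cite: GrossLMS1991, Prop. 6.2, §9 Prop. 9.1] [cite: McCallumLMS1991, §5] [cite: MazurRubin2004, Thm. 2.3.4 (global duality)] -/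
def SeedPrimeSwapAtTwo : Prop :=
  ∀ (W : WeierstrassCurve ℚ) [W.IsElliptic] [W.IsGloballyMinimal], ¬ W.HasCM → (Literature.NumberTheory.EllipticCurves.Rank1Residual.GoodOrd W 2 ∨ Literature.NumberTheory.EllipticCurves.Rank1Residual.Mult W 2) → (∀ m : ℕ, W.HasSurjectiveModNGaloisRep (2 ^ m : ℕ)) → ∀ (K : Type) [Field K] [NumberField K], Literature.NumberTheory.EllipticCurves.IsImaginaryQuadratic K → ∀ [NeZero (W.conductorNorm ℤ)], Literature.NumberTheory.EllipticCurves.SatisfiesHeegnerHypothesis (W.conductorNorm ℤ) K → Odd (NumberField.discr K) → NumberField.discr K ≠ -3 → AddSubgroup.torsionBy (W.baseChange K).toAffine.Point (2 : ℤ) = ⊥ → Literature.NumberTheory.EllipticCurves.SatisfiesHeegnerHypothesis 2 K → ∀ (Dt : Literature.NumberTheory.EllipticCurves.ModularForms.ModularParametrizationData W (W.conductorNorm ℤ)) (β : ℤ) (ι : K →+* ℂ) [∀ k : ℕ, NumberField (ringClassField K ι k)], (4 * (W.conductorNorm ℤ : ℤ)) ∣ β ^ 2 - NumberField.discr K →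
    ∃ κ B : ℕ, ∀ (I M v s e : ℕ) (d : Literature.NumberTheory.EllipticCurves.KolyvaginHeegnerData Dt β ι (s * e)),
      Literature.NumberTheory.EllipticCurves.KolyvaginDescent.KolSupp (Literature.NumberTheory.EllipticCurves.Zhang2014.IsKolyvaginPrime (W.conductorNorm ℤ) W K 2) (s * e) →
      s ≠ 1 → 1 ≤ M → M ≤ I → ((M : ℕ) : ℕ∞) ≤ Literature.NumberTheory.EllipticCurves.Zhang2014.levelIndex W 2 (s * e) →
      (∀ p ∈ e.primeFactors, I ≤ Literature.NumberTheory.EllipticCurves.Zhang2014.kolyvaginIndex W 2 p ∧ (∃ (pl : HeightOneSpectrum (𝓞 ℚ)) (𝔓 : Ideal (absIntegers (𝓞 ℚ) ℚ)) (h : absoluteGaloisGroup ℚ), (p : 𝓞 ℚ) ∈ pl.asIdeal ∧ 𝔓 ∈ pl.primesAbove ∧ IsArithFrobAt (𝓞 ℚ) h 𝔓 ∧ (∀ X : geomTorsion W ((2 ^ M : ℕ) : ℤ), h • h • X = X) ∧ ∃ P : geomTorsion W ((2 ^ M : ℕ) : ℤ), (2 : ℤ) ^ (M - 1) • (P + h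 • P) ≠ 0)) →
      (∃ x ∈ Jetchev2008.modifiedSelmerGroup W K ι ((2 ^ M : ℕ) : ℤ) e, addOrderOf x = 2 ^ M) →
      (∃ ρ ∈ torsionFixing (W.baseChange K) ((2 ^ M : ℕ) : ℤ),
          ((2 ^ (v + κ) : ℕ) : ℤ) • h1Eval (W.baseChange K) ((2 ^ M : ℕ) : ℤ) (d.kolyvaginClass Nat.prime_two M) ρ ≠ 0) →
      ∃ (q s' f : ℕ) (d' : Literature.NumberTheory.EllipticCurves.KolyvaginHeegnerData Dt β ι (s' * (e * f))),
        s = q * s' ∧ q.Prime ∧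
        (∀ p ∈ (e * f).primeFactors, I ≤ Literature.NumberTheory.EllipticCurves.Zhang2014.kolyvaginIndex W 2 p ∧ (∃ (pl : HeightOneSpectrum (𝓞 ℚ)) (𝔓 : Ideal (absIntegers (𝓞 ℚ) ℚ)) (h : absoluteGaloisGroup ℚ), (p : 𝓞 ℚ) ∈ pl.asIdeal ∧ 𝔓 ∈ pl.primesAbove ∧ IsArithFrobAt (𝓞 ℚ) h 𝔓 ∧ (∀ X : geomTorsion W ((2 ^ M : ℕ) : ℤ), h • h • X = X) ∧ ∃ P : geomTorsion W ((2 ^ M : ℕ) : ℤ), (2 : ℤ) ^ (M - 1) • (P + h • P) ≠ 0)) ∧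
        s'.primeFactors.card + 1 = s.primeFactors.card ∧
        (s' * (e * f)).primeFactors.card = (s * e).primeFactors.card + B ∧
        Literature.NumberTheory.EllipticCurves.KolyvaginDescent.KolSupp (Literature.NumberTheory.EllipticCurves.Zhang2014.IsKolyvaginPrime (W.conductorNorm ℤ) W K 2) (s' * (e * f)) ∧
        ((M : ℕ) : ℕ∞) ≤ Literature.NumberTheory.EllipticCurves.Zhang2014.levelIndex W 2 (s' * (e * f)) ∧
        (∃ x' ∈ Jetchev2008.modifiedSelmerGroup W K ι ((2 ^ M : ℕ) : ℤ) (e * f), addOrderOf x' = 2 ^ M) ∧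
        ∃ ρ ∈ torsionFixing (W.baseChange K) ((2 ^ M : ℕ) : ℤ),
          ((2 ^ v : ℕ) : ℤ) • h1Eval (W.baseChange K) ((2 ^ M : ℕ) : ℤ) (d'.kolyvaginClass Nat.prime_two M) ρ ≠ 0

/-- SL · START LINE (the frame at the empty engine part `e = 1`): every `Sel_{2^M}(E/K) = H_{𝓕(1)}(K, E[2^M])` contains a class of exact
order `2^M`.  A TREE THEOREM (no stub): `RegularWalk.startFrameAtTwo_holds` (corank `≥ 1` from Kramer–Monsky 2-parity + Cassels–Tate,
`E(K)[2] = 0`). [cite: Monsky1996, Lemma 1.4(b)] [cite: Kramer1981, Thm. 1] -/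
def StartLineAtTwo : Prop :=
  ∀ (W : WeierstrassCurve ℚ) [W.IsElliptic] [W.IsGloballyMinimal], ¬ W.HasCM → (Literature.NumberTheory.EllipticCurves.Rank1Residual.GoodOrd W 2 ∨ Literature.NumberTheory.EllipticCurves.Rank1Residual.Mult W 2) → (∀ m : ℕ, W.HasSurjectiveModNGaloisRep (2 ^ m : ℕ)) → ∀ (K : Type) [Field K] [NumberField K], Literature.NumberTheory.EllipticCurves.IsImaginaryQuadratic K → ∀ [NeZero (W.conductorNorm ℤ)], Literature.NumberTheory.EllipticCurves.SatisfiesHeegnerHypothesis (W.conductorNorm ℤ) K → Odd (NumberField.discr K) → NumberField.discr K ≠ -3 → AddSubgroup.torsionBy (W.baseChange K).toAffine.Point (2 : ℤ) = ⊥ → Literature.NumberTheory.EllipticCurves.SatisfiesHeegnerHypothesis 2 K → ∀ (Dt : Literature.NumberTheory.EllipticCurves.ModularForms.ModularParametrizationData W (W.conductorNorm ℤ)) (β : ℤ) (ι : K →+* ℂ) [∀ k : ℕ, NumberField (ringClassField K ι k)], (4 * (W.conductorNorm ℤ : ℤ)) ∣ β ^ 2 - NumberField.discr K →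
    ∀ M : ℕ, 1 ≤ M → ∃ x ∈ Jetchev2008.modifiedSelmerGroup W K ι ((2 ^ M : ℕ) : ℤ) 1, addOrderOf x = 2 ^ M

/-- **SL holds** (kernel, by name): the `i₀`-th class of the tree's start frame. -/
theorem startLineAtTwo_holds : StartLineAtTwo := by
  intro W _ _ hCM hred hsurj K _ _ hK _ hH hodd hd3 htors hH2 Dt β ι _ hβ M hM
  obtain ⟨τ, hτ1⟩ := Summit.BirchSwinnertonDyer.Rank1Residual.JET.exists_algEquiv_ne_one_of_isImaginaryQuadratic K hK
  obtain ⟨m, sg, i₀, J, dd, _, _, hframe⟩ :=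
    KolyvaginAtTwo.RegularWalk.startFrameAtTwo_holds W hCM hred hsurj K hK hH hodd hd3 htors hH2 Dt β ι hβ τ hτ1
  obtain ⟨g, hg, _, hord, _⟩ := hframe M hM
  exact ⟨g i₀, hg i₀, hord⟩

/-- S0ʳ (INPUT stub). -/
theorem stub_roomSeedAtTwo : KolyvaginRoomSeedAtTwo := by
  sorry


/-! ## §5 (v7.1) THE CUT OF SW: SW ⟸ {SWα shed-by-reciprocity (NEW), Q2 Kolyvagin relation at 2 (GK2 item 24880: PROVED in tree modulo
the PRINT fact Gross 1991 Prop. 3.7(2) = Nekovář 2007 Prop. 4.9, `GenusExact.kolyvaginRelationAtTwo_of_frobeniusCongruence`, p614530),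
EV singular-to-visible (routine local criterion `mem_torsionLocalKer_iff_h1Eval_eq_zero`)} — kernel-checked `seedPrimeSwapAtTwo_of`. -/

/-- SWα · SHED A SEED PRIME BY RECIPROCITY (THE genuinely new theorem of v7, L).  Same hypotheses as SW; conclusion: a seed prime `q`
(`s = q·s'`), a block `f` of `B+1` new REGULAR engine primes of index `≥ I` with the frame carried to `e·f`, a datum `d'` at `m := s'·(e·f)` and a
datum `dup` at `m·q` (= `n·f` re-ordered) COMPATIBLE with `d'` in the sense of GK2's Q2 (`KolyvaginRelationAtTwo`: the four σ / S / emb clauses,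
copied verbatim), such that `2^v · c_M(m·q)` is NOT Selmer-local at the prime `w ∣ q` of `K` — i.e. the SINGULAR part of `c_M(nℓ)` at `q` has
order `> 2^v`.  Blueprint: engine prime `ℓ` with aligned exact values on `(c_M(n), x)`; `B := ⟨φ_ℓ loc^f_λ c_M(n), loc^f_λ x⟩_λ` of order `> 2^v`
(UP relation, Q2 at `ℓ`); Poitou–Tate for `(c_M(nℓ), x)`: zero at `e` (both transverse), bounded by `κ` at `v ∣ 2N`, so the seed primes carry
`−B`; pick the `q ∣ s` with the largest term.  Why it might fail: (a) visible dependence of `c_M(n)` and `x` mod 2 (then `B = 0`: re-frame /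
detour), (b) uniform bound at `v ∣ 2N`, (c) joint Čebotarev for values + frame + parity lift.
[cite: Kolyvagin1991StructureSha, Prop. 8] [cite: Kolyvagin1991MathAnn, Thm. 2.2 (proof)] [cite: MazurRubin2004, Thm. 2.3.4] [cite: McCallumLMS1991, §5] -/
def ShedSeedPrimeAtTwo : Prop :=
  ∀ (W : WeierstrassCurve ℚ) [W.IsElliptic] [W.IsGloballyMinimal], ¬ W.HasCM → (Literature.NumberTheory.EllipticCurves.Rank1Residual.GoodOrd W 2 ∨ Literature.NumberTheory.EllipticCurves.Rank1Residual.Mult W 2) → (∀ m : ℕ, W.HasSurjectiveModNGaloisRep (2 ^ m : ℕ)) → ∀ (K : Type) [Field K] [NumberField K], Literature.NumberTheory.EllipticCurves.IsImaginaryQuadratic K → ∀ [NeZero (W.conductorNorm ℤ)], Literature.NumberTheory.EllipticCurves.SatisfiesHeegnerHypothesis (W.conductorNorm ℤ) K → Odd (NumberField.discr K) → NumberField.discr K ≠ -3 → AddSubgroup.torsionBy (W.baseChange K).toAffine.Point (2 : ℤ) = ⊥ → Literature.NumberTheory.EllipticCurves.SatisfiesHeegnerHypothesis 2 K → ∀ (Dt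 : Literature.NumberTheory.EllipticCurves.ModularForms.ModularParametrizationData W (W.conductorNorm ℤ)) (β : ℤ) (ι : K →+* ℂ) [∀ k : ℕ, NumberField (ringClassField K ι k)], (4 * (W.conductorNorm ℤ : ℤ)) ∣ β ^ 2 - NumberField.discr K →
    ∃ κ B : ℕ, ∀ (I M v s e : ℕ) (d : Literature.NumberTheory.EllipticCurves.KolyvaginHeegnerData Dt β ι (s * e)),
      Literature.NumberTheory.EllipticCurves.KolyvaginDescent.KolSupp (Literature.NumberTheory.EllipticCurves.Zhang2014.IsKolyvaginPrime (W.conductorNorm ℤ) W K 2) (s * e) →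
      s ≠ 1 → 1 ≤ M → M ≤ I → ((M : ℕ) : ℕ∞) ≤ Literature.NumberTheory.EllipticCurves.Zhang2014.levelIndex W 2 (s * e) →
      (∀ p ∈ e.primeFactors, I ≤ Literature.NumberTheory.EllipticCurves.Zhang2014.kolyvaginIndex W 2 p ∧ (∃ (pl : HeightOneSpectrum (𝓞 ℚ)) (𝔓 : Ideal (absIntegers (𝓞 ℚ) ℚ)) (h : absoluteGaloisGroup ℚ), (p : 𝓞 ℚ) ∈ pl.asIdeal ∧ 𝔓 ∈ pl.primesAbove ∧ IsArithFrobAt (𝓞 ℚ) h 𝔓 ∧ (∀ X : geomTorsion W ((2 ^ M : ℕ) : ℤ), h • h • X = X) ∧ ∃ P : geomTorsion W ((2 ^ M : ℕ) : ℤ), (2 : ℤ) ^ (M - 1) • (P + h • P) ≠ 0)) →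
      (∃ x ∈ Jetchev2008.modifiedSelmerGroup W K ι ((2 ^ M : ℕ) : ℤ) e, addOrderOf x = 2 ^ M) →
      (∃ ρ ∈ torsionFixing (W.baseChange K) ((2 ^ M : ℕ) : ℤ),
          ((2 ^ (v + κ) : ℕ) : ℤ) • h1Eval (W.baseChange K) ((2 ^ M : ℕ) : ℤ) (d.kolyvaginClass Nat.prime_two M) ρ ≠ 0) →
      ∃ (q s' f : ℕ) (d' : Literature.NumberTheory.EllipticCurves.KolyvaginHeegnerData Dt β ι (s' * (e * f))),
        s = q * s' ∧ q.Prime ∧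
        (∀ p ∈ (e * f).primeFactors, I ≤ Literature.NumberTheory.EllipticCurves.Zhang2014.kolyvaginIndex W 2 p ∧ (∃ (pl : HeightOneSpectrum (𝓞 ℚ)) (𝔓 : Ideal (absIntegers (𝓞 ℚ) ℚ)) (h : absoluteGaloisGroup ℚ), (p : 𝓞 ℚ) ∈ pl.asIdeal ∧ 𝔓 ∈ pl.primesAbove ∧ IsArithFrobAt (𝓞 ℚ) h 𝔓 ∧ (∀ X : geomTorsion W ((2 ^ M : ℕ) : ℤ), h • h • X = X) ∧ ∃ P : geomTorsion W ((2 ^ M : ℕ) : ℤ), (2 : ℤ) ^ (M - 1) • (P + h • P) ≠ 0)) ∧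
        s'.primeFactors.card + 1 = s.primeFactors.card ∧
        (s' * (e * f)).primeFactors.card = (s * e).primeFactors.card + B ∧
        Literature.NumberTheory.EllipticCurves.KolyvaginDescent.KolSupp (Literature.NumberTheory.EllipticCurves.Zhang2014.IsKolyvaginPrime (W.conductorNorm ℤ) W K 2) (s' * (e * f)) ∧
        ((M : ℕ) : ℕ∞) ≤ Literature.NumberTheory.EllipticCurves.Zhang2014.levelIndex W 2 (s' * (e * f)) ∧
        (∃ x' ∈ Jetchev2008.modifiedSelmerGroup W K ι ((2 ^ M : ℕ) : ℤ) (e * f), addOrderOf x' = 2 ^ M) ∧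
        ∃ dup : Literature.NumberTheory.EllipticCurves.KolyvaginHeegnerData Dt β ι (s' * (e * f) * q),
        Squarefree (s' * (e * f) * q) ∧ ¬ q ∣ s' * (e * f) ∧
        (∀ l' ∈ (s' * (e * f) * q).primeFactors, Literature.NumberTheory.EllipticCurves.Zhang2014.IsKolyvaginPrime (W.conductorNorm ℤ) W K 2 l' ∧ M ≤ Literature.NumberTheory.EllipticCurves.Zhang2014.kolyvaginIndex W 2 l') ∧
        (∀ l' ∈ (s' * (e * f)).primeFactors, ∀ (x : Literature.NumberTheory.EllipticCurves.ringClassField K ι (s' * (e * f))) (x' : Literature.NumberTheory.EllipticCurves.ringClassField K ι (s' * (e * f) * q)), (x : ℂ) = x' → ((dup.σ l' x' : Literature.NumberTheory.EllipticCurves.ringClassField K ι (s' * (e * f) * q)) : ℂ) = (d'.σ l' x : ℂ)) ∧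
        (∀ t ∈ d'.S, ∃ t' ∈ dup.S, ∀ (x : Literature.NumberTheory.EllipticCurves.ringClassField K ι (s' * (e * f))) (x' : Literature.NumberTheory.EllipticCurves.ringClassField K ι (s' * (e * f) * q)), (x : ℂ) = x' → ((t' x' : Literature.NumberTheory.EllipticCurves.ringClassField K ι (s' * (e * f) * q)) : ℂ) = (t x : ℂ)) ∧
        (∀ t' ∈ dup.S, ∃ t ∈ d'.S, ∀ (x : Literature.NumberTheory.EllipticCurves.ringClassField K ι (s' * (e * f))) (x' : Literature.NumberTheory.EllipticCurves.ringClassField K ι (s' * (e * f) * q)), (x : ℂ) = x' → ((t' x' : Literature.NumberTheory.EllipticCurves.ringClassField K ι (s' * (e * f) * q)) : ℂ) = (t x : ℂ)) ∧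
        (∀ (x : Literature.NumberTheory.EllipticCurves.ringClassField K ι (s' * (e * f))) (x' : Literature.NumberTheory.EllipticCurves.ringClassField K ι (s' * (e * f) * q)), (x : ℂ) = x' → dup.emb x' = d'.emb x) ∧
        ∃ w : IsDedekindDomain.HeightOneSpectrum (NumberField.RingOfIntegers K), (q : NumberField.RingOfIntegers K) ∈ w.asIdeal ∧
          ((2 ^ v : ℕ) : ℤ) • dup.kolyvaginClass Nat.prime_two M ∉ WeierstrassCurve.selmerLocalKer (W.baseChange K) (w.adicCompletion K) ((2 ^ M : ℕ) : ℤ)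

/-- EV · SINGULAR-TO-VISIBLE (routine support, S): for a square-free Kolyvagin conductor `m·q` (`q ∤ m` prime, all indices `≥ M ≥ 1`) and a
datum `d` at `m`, if `2^j · c_M(m)` is not locally trivial at the prime `w ∣ q` of `K` then `c_M(m)` has VISIBLE order `> 2^j`: `c_M(m)` is
unramified at `w` (`q ∤ 2Nm`), `D_w ≤ Γ_{K(E[2^M])}` (`q` Kolyvagin of index `≥ M`: `Frob_w = Frob_q²` and inertia act trivially on `E[2^M]`),
so `loc_w` is evaluation at a Frobenius lift `ρ ∈ D_w` — the tree's local criterion `mem_torsionLocalKer_iff_h1Eval_eq_zero` + `h1Eval_zsmul`.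
[cite: GrossLMS1991, §9, Prop. 9.1] [cite: McCallumLMS1991, Prop. 4.4 (3)] -/
def SingularToVisibleAtTwo : Prop :=
  ∀ (W : WeierstrassCurve ℚ) [W.IsElliptic] [W.IsGloballyMinimal], ¬ W.HasCM → (Literature.NumberTheory.EllipticCurves.Rank1Residual.GoodOrd W 2 ∨ Literature.NumberTheory.EllipticCurves.Rank1Residual.Mult W 2) → (∀ m : ℕ, W.HasSurjectiveModNGaloisRep (2 ^ m : ℕ)) → ∀ (K : Type) [Field K] [NumberField K], Literature.NumberTheory.EllipticCurves.IsImaginaryQuadratic K → ∀ [NeZero (W.conductorNorm ℤ)], Literature.NumberTheory.EllipticCurves.SatisfiesHeegnerHypothesis (W.conductorNorm ℤ) K → Odd (NumberField.discr K) → NumberField.discr K ≠ -3 → AddSubgroup.torsionBy (W.baseChange K).toAffine.Point (2 : ℤ) = ⊥ → Literature.NumberTheory.EllipticCurves.SatisfiesHeegnerHypothesis 2 K → ∀ (Dt : Literature.NumberTheory.EllipticCurves.ModularForms.ModularParametrizationData W (W.conductorNorm ℤ)) (β : ℤ) (ι : K →+* ℂ) [∀ k : ℕ, NumberField (ringClassField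 K ι k)], (4 * (W.conductorNorm ℤ : ℤ)) ∣ β ^ 2 - NumberField.discr K →
    ∀ (M m q j : ℕ) (d : Literature.NumberTheory.EllipticCurves.KolyvaginHeegnerData Dt β ι m), 1 ≤ M → Squarefree (m * q) → q.Prime → ¬ q ∣ m →
      (∀ l' ∈ (m * q).primeFactors, Literature.NumberTheory.EllipticCurves.Zhang2014.IsKolyvaginPrime (W.conductorNorm ℤ) W K 2 l' ∧ M ≤ Literature.NumberTheory.EllipticCurves.Zhang2014.kolyvaginIndex W 2 l') →
      ∀ (w : IsDedekindDomain.HeightOneSpectrum (NumberField.RingOfIntegers K)), (q : NumberField.RingOfIntegers K) ∈ w.asIdeal →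
      ((2 ^ j : ℕ) : ℤ) • d.kolyvaginClass Nat.prime_two M ∉ (W.baseChange K).torsionLocalKer (w.adicCompletion K) ((2 ^ M : ℕ) : ℤ) →
      ∃ ρ ∈ torsionFixing (W.baseChange K) ((2 ^ M : ℕ) : ℤ),
        ((2 ^ j : ℕ) : ℤ) • h1Eval (W.baseChange K) ((2 ^ M : ℕ) : ℤ) (d.kolyvaginClass Nat.prime_two M) ρ ≠ 0

/-- SWα (THE load-bearing stub of v7.1). -/
theorem stub_shedSeedPrimeAtTwo : ShedSeedPrimeAtTwo := by
  sorry

/-- P372 · PRINT stub: Gross 1991 Prop. 3.7(2) / Nekovář 2007 Prop. 4.9 (Eichler–Shimura congruence for Heegner points; image-free named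
Literature fact, the one print input under which GK2's Q2 at 2 is a tree theorem). -/
theorem stub_heegnerCongruence : Literature.NumberTheory.EllipticCurves.GrossLMS1991.prop37_2_frobeniusCongruence := by
  sorry

/-- Q2 at 2 BY NAME (GK2 item stmt-BirchSwinnertonDyer-24880), a tree theorem modulo P372 (gk2-p2 g7, p614530). -/
theorem kolyvaginRelationAtTwo_of_print :
    Summit.BirchSwinnertonDyer.BirchSwinnertonDyer.Theses.GenusKolyvaginAtTwo.KolyvaginRelationAtTwo :=
  Summit.BirchSwinnertonDyer.BirchSwinnertonDyer.Theorems.GenusExact.kolyvaginRelationAtTwo_of_frobeniusCongruence stub_heegnerCongruence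

/-- EV (routine support stub). -/
theorem stub_singularToVisibleAtTwo : SingularToVisibleAtTwo := by
  sorry

/-- **THE CUT (kernel): SWα + Q2-at-2 + EV ⟹ SW.**  From SWα's `2^v c_M(mq) ∉ Sel-local_w`: Q2's first equivalence (at the prime `q` of the
conductor `mq`, Selmer-local ⟺ locally trivial) gives `2^v c_M(mq) ∉ tors-local_w`; Q2's second equivalence (the DOWN reading: `c_M(mq)` locally
trivial at `w` ⟺ `c_M(m)` locally trivial at `w`) gives `2^v c_M(m) ∉ tors-local_w`; EV turns that into visible order `> 2^v`. -/
theorem seedPrimeSwapAtTwo_of (hα : ShedSeedPrimeAtTwo)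
    (hQ2 : Summit.BirchSwinnertonDyer.BirchSwinnertonDyer.Theses.GenusKolyvaginAtTwo.KolyvaginRelationAtTwo)
    (hEV : SingularToVisibleAtTwo) : SeedPrimeSwapAtTwo := by
  intro W _ _ hCM hred hsurj K _ _ hK _ hH hodd hd3 htors hH2 Dt β ι _ hβ
  obtain ⟨κ, B, hshed⟩ := hα W hCM hred hsurj K hK hH hodd hd3 htors hH2 Dt β ι hβ
  have hev := hEV W hCM hred hsurj K hK hH hodd hd3 htors hH2 Dt β ι hβ
  have hd4 : NumberField.discr K ≠ -4 := by
    intro h4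
    obtain ⟨k, hk⟩ := hodd
    omega
  refine ⟨κ, B, fun I M v s e d hKol hs1 hM hMI hidx hdeep hframe hvis ↦ ?_⟩
  obtain ⟨q, s', f, d', hsq, hq, hdeepf, hcard', hcardn, hKol', hidx', hframe', dup, hsqf, hqm, hall, hcσ, hcS₁, hcS₂,
    hcemb, w, hw, hnotSel⟩ := hshed I M v s e d hKol hs1 hM hMI hidx hdeep hframe hvis
  refine ⟨q, s', f, d', hsq, hq, hdeepf, hcard', hcardn, hKol', hidx', hframe', ?_⟩
  have hrel := hQ2 W hCM K hK hd3 hd4 hH hsurj Dt β ι M hM (s' * (e * f)) q hsqf hq hqm hall d' dup hcσ hcS₁ hcS₂ hcemb w hw v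
  have hnotTors : ((2 ^ v : ℕ) : ℤ) • dup.kolyvaginClass Nat.prime_two M ∉
      (W.baseChange K).torsionLocalKer (w.adicCompletion K) ((2 ^ M : ℕ) : ℤ) := fun h ↦ hnotSel (hrel.1.mpr h)
  have hnotTors' : ((2 ^ v : ℕ) : ℤ) • d'.kolyvaginClass Nat.prime_two M ∉
      (W.baseChange K).torsionLocalKer (w.adicCompletion K) ((2 ^ M : ℕ) : ℤ) := fun h ↦ hnotTors (hrel.2.mpr h)
  exact hev M (s' * (e * f)) q v d' hM hsqf hq hqm hall w hw hnotTors'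

/-- SW from the v7.1 stubs (sorry-free composition). -/
theorem seedPrimeSwapAtTwo_of_stubs : SeedPrimeSwapAtTwo :=
  seedPrimeSwapAtTwo_of stub_shedSeedPrimeAtTwo kolyvaginRelationAtTwo_of_print stub_singularToVisibleAtTwo

/-- THE WALK (kernel): with room `κ · #(seed primes)` the seed primes are shed one at a time (strong induction on their number), keeping
the depth, the level, the engine-part frame and the deep-index invariant; at the end the conductor is all engine primes (index `≥ M*`) and the
class at the FIXED level is visibly non-zero, hence non-zero (`h1Eval_zero`). -/
theorem walk (W : WeierstrassCurve ℚ) [W.IsElliptic] [W.IsGloballyMinimal] {K : Type} [Field K] [NumberField K] [NeZero (W.conductorNorm ℤ)]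
    {Dt : Literature.NumberTheory.EllipticCurves.ModularForms.ModularParametrizationData W (W.conductorNorm ℤ)} {β : ℤ} {ι : K →+* ℂ}
    [∀ k : ℕ, NumberField (ringClassField K ι k)] {κ B M Mstar r : ℕ} (hM : 1 ≤ M) (hMstar : M ≤ Mstar)
    (hswap : ∀ (I M v s e : ℕ) (d : Literature.NumberTheory.EllipticCurves.KolyvaginHeegnerData Dt β ι (s * e)),
      Literature.NumberTheory.EllipticCurves.KolyvaginDescent.KolSupp (Literature.NumberTheory.EllipticCurves.Zhang2014.IsKolyvaginPrime (W.conductorNorm ℤ) W K 2) (s * e) →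
      s ≠ 1 → 1 ≤ M → M ≤ I → ((M : ℕ) : ℕ∞) ≤ Literature.NumberTheory.EllipticCurves.Zhang2014.levelIndex W 2 (s * e) →
      (∀ p ∈ e.primeFactors, I ≤ Literature.NumberTheory.EllipticCurves.Zhang2014.kolyvaginIndex W 2 p ∧ (∃ (pl : HeightOneSpectrum (𝓞 ℚ)) (𝔓 : Ideal (absIntegers (𝓞 ℚ) ℚ)) (h : absoluteGaloisGroup ℚ), (p : 𝓞 ℚ) ∈ pl.asIdeal ∧ 𝔓 ∈ pl.primesAbove ∧ IsArithFrobAt (𝓞 ℚ) h 𝔓 ∧ (∀ X : geomTorsion W ((2 ^ M : ℕ) : ℤ), h • h • X = X) ∧ ∃ P : geomTorsion W ((2 ^ M : ℕ) : ℤ), (2 : ℤ) ^ (M - 1) • (P + h • P) ≠ 0)) →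
      (∃ x ∈ Jetchev2008.modifiedSelmerGroup W K ι ((2 ^ M : ℕ) : ℤ) e, addOrderOf x = 2 ^ M) →
      (∃ ρ ∈ torsionFixing (W.baseChange K) ((2 ^ M : ℕ) : ℤ),
          ((2 ^ (v + κ) : ℕ) : ℤ) • h1Eval (W.baseChange K) ((2 ^ M : ℕ) : ℤ) (d.kolyvaginClass Nat.prime_two M) ρ ≠ 0) →
      ∃ (q s' f : ℕ) (d' : Literature.NumberTheory.EllipticCurves.KolyvaginHeegnerData Dt β ι (s' * (e * f))),
        s = q * s' ∧ q.Prime ∧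
        (∀ p ∈ (e * f).primeFactors, I ≤ Literature.NumberTheory.EllipticCurves.Zhang2014.kolyvaginIndex W 2 p ∧ (∃ (pl : HeightOneSpectrum (𝓞 ℚ)) (𝔓 : Ideal (absIntegers (𝓞 ℚ) ℚ)) (h : absoluteGaloisGroup ℚ), (p : 𝓞 ℚ) ∈ pl.asIdeal ∧ 𝔓 ∈ pl.primesAbove ∧ IsArithFrobAt (𝓞 ℚ) h 𝔓 ∧ (∀ X : geomTorsion W ((2 ^ M : ℕ) : ℤ), h • h • X = X) ∧ ∃ P : geomTorsion W ((2 ^ M : ℕ) : ℤ), (2 : ℤ) ^ (M - 1) • (P + h • P) ≠ 0)) ∧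
        s'.primeFactors.card + 1 = s.primeFactors.card ∧
        (s' * (e * f)).primeFactors.card = (s * e).primeFactors.card + B ∧
        Literature.NumberTheory.EllipticCurves.KolyvaginDescent.KolSupp (Literature.NumberTheory.EllipticCurves.Zhang2014.IsKolyvaginPrime (W.conductorNorm ℤ) W K 2) (s' * (e * f)) ∧
        ((M : ℕ) : ℕ∞) ≤ Literature.NumberTheory.EllipticCurves.Zhang2014.levelIndex W 2 (s' * (e * f)) ∧
        (∃ x' ∈ Jetchev2008.modifiedSelmerGroup W K ι ((2 ^ M : ℕ) : ℤ) (e * f), addOrderOf x' = 2 ^ M) ∧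
        ∃ ρ ∈ torsionFixing (W.baseChange K) ((2 ^ M : ℕ) : ℤ),
          ((2 ^ v : ℕ) : ℤ) • h1Eval (W.baseChange K) ((2 ^ M : ℕ) : ℤ) (d'.kolyvaginClass Nat.prime_two M) ρ ≠ 0)
    (hstart : ∃ x ∈ Jetchev2008.modifiedSelmerGroup W K ι ((2 ^ M : ℕ) : ℤ) 1, addOrderOf x = 2 ^ M) :
    ∀ (j : ℕ) (s e v n : ℕ) (d : Literature.NumberTheory.EllipticCurves.KolyvaginHeegnerData Dt β ι n), n = s * e →
      s.primeFactors.card ≤ j →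
      Literature.NumberTheory.EllipticCurves.KolyvaginDescent.KolSupp (Literature.NumberTheory.EllipticCurves.Zhang2014.IsKolyvaginPrime (W.conductorNorm ℤ) W K 2) n →
      n.primeFactors.card + B * s.primeFactors.card = r + B * r → ((M : ℕ) : ℕ∞) ≤ Literature.NumberTheory.EllipticCurves.Zhang2014.levelIndex W 2 n →
      (∀ p ∈ e.primeFactors, Mstar ≤ Literature.NumberTheory.EllipticCurves.Zhang2014.kolyvaginIndex W 2 p ∧ (∃ (pl : HeightOneSpectrum (𝓞 ℚ)) (𝔓 : Ideal (absIntegers (𝓞 ℚ) ℚ)) (h : absoluteGaloisGroup ℚ), (p : 𝓞 ℚ) ∈ pl.asIdeal ∧ 𝔓 ∈ pl.primesAbove ∧ IsArithFrobAt (𝓞 ℚ) h 𝔓 ∧ (∀ X : geomTorsion W ((2 ^ M : ℕ) : ℤ), h • h • X = X) ∧ ∃ P : geomTorsion W ((2 ^ M : ℕ) : ℤ), (2 : ℤ) ^ (M - 1) • (P + h • P) ≠ 0)) →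
      (e = 1 ∨ ∃ x ∈ Jetchev2008.modifiedSelmerGroup W K ι ((2 ^ M : ℕ) : ℤ) e, addOrderOf x = 2 ^ M) →
      s.primeFactors.card * κ ≤ v →
      (∃ ρ ∈ torsionFixing (W.baseChange K) ((2 ^ M : ℕ) : ℤ),
          ((2 ^ v : ℕ) : ℤ) • h1Eval (W.baseChange K) ((2 ^ M : ℕ) : ℤ) (d.kolyvaginClass Nat.prime_two M) ρ ≠ 0) →
      ∃ (n' : ℕ) (d' : Literature.NumberTheory.EllipticCurves.KolyvaginHeegnerData Dt β ι n'),
        Literature.NumberTheory.EllipticCurves.KolyvaginDescent.KolSupp (Literature.NumberTheory.EllipticCurves.Zhang2014.IsKolyvaginPrime (W.conductorNorm ℤ) W K 2) n' ∧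
        n'.primeFactors.card = r + B * r ∧ ((Mstar : ℕ) : ℕ∞) ≤ Literature.NumberTheory.EllipticCurves.Zhang2014.levelIndex W 2 n' ∧
        d'.kolyvaginClass Nat.prime_two M ≠ 0 := by
  intro j
  induction j with
  | zero =>
    intro s e v n d hn hj hKol hcard hidx hdeep _ _ hvis
    have hs0 : s.primeFactors = ∅ := Finset.card_eq_zero.mp (Nat.le_zero.mp hj)
    rcases Nat.primeFactors_eq_empty.mp hs0 with h0 | h1
    · exfalso
      subst h0
      have h00 : n = 0 := by rw [hn, Nat.zero_mul]
      exact (hKol.1.ne_zero) h00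
    · subst h1
      have hne : n = e := by rw [hn, Nat.one_mul]
      have hcard0 : n.primeFactors.card = r + B * r := by simpa [Nat.primeFactors_one] using hcard
      refine ⟨n, d, hKol, hcard0, ?_, ?_⟩
      · exact Zhang2014.natCast_le_levelIndex_iff.mpr fun p hp ↦ (hdeep p (by rw [← hne]; exact hp)).1
      · obtain ⟨ρ, hρ, hval⟩ := hvis
        intro hc
        apply hval
        rw [hc, h1Eval_zero _ _ hρ, smul_zero]
  | succ j ih =>
    intro s e v n d hn hj hKol hcard hidx hdeep hframe hv hvis
    by_cases hsj : s.primeFactors.card ≤ j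
    · exact ih s e v n d hn hsj hKol hcard hidx hdeep hframe hv hvis
    · have hcs : s.primeFactors.card = j + 1 := by omega
      have hs1 : s ≠ 1 := by
        rintro rfl
        simp [Nat.primeFactors_one] at hcs
      -- the frame at the engine part: at `e = 1` from the start line
      have hframe' : ∃ x ∈ Jetchev2008.modifiedSelmerGroup W K ι ((2 ^ M : ℕ) : ℤ) e, addOrderOf x = 2 ^ M := by
        rcases hframe with he | hx
        · rw [he]; exact hstart
        · exact hx
      -- room: `κ ≤ v` and the budget of the new state
      have hκv : κ ≤ v := by
        have h1 : κ ≤ s.primeFactors.card * κ := by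
          rw [hcs]; exact Nat.le_mul_of_pos_left κ (Nat.succ_pos j)
        exact le_trans h1 hv
      have hvis' : ∃ ρ ∈ torsionFixing (W.baseChange K) ((2 ^ M : ℕ) : ℤ),
          ((2 ^ ((v - κ) + κ) : ℕ) : ℤ) • h1Eval (W.baseChange K) ((2 ^ M : ℕ) : ℤ) (d.kolyvaginClass Nat.prime_two M) ρ ≠ 0 := by
        rw [Nat.sub_add_cancel hκv]; exact hvis
      subst hn
      obtain ⟨q, s', f, d', hsq, hq, hdeep', hcard', hcardn', hKol', hidx', hframeℓ, hvisℓ⟩ :=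
        hswap Mstar M (v - κ) s e d hKol hs1 hM hMstar hidx hdeep hframe' hvis'
      have hs'j : s'.primeFactors.card ≤ j := by omega
      have hcard'' : (s' * (e * f)).primeFactors.card + B * s'.primeFactors.card = r + B * r := by
        rw [hcardn']
        rw [← hcard', Nat.mul_succ] at hcard
        omega
      have hv' : s'.primeFactors.card * κ ≤ v - κ := by
        have h2 : s'.primeFactors.card * κ + κ ≤ v := by
          have h3 : (s'.primeFactors.card + 1) * κ ≤ v := by rw [hcard']; exact hv
          simpa [Nat.add_mul] using h3
        omega
      exact ih s' (e * f) (v - κ) (s' * (e * f)) d' rfl hs'j hKol' hcard'' hidx' hdeep' (Or.inr hframeℓ) hv' hvisℓ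

/-- **{S0ʳ, SL, SW} ⟹ DeepSeedAtTwo** (kernel): `κ` from SW, `r` from S0ʳ, ONE seed with room `r·κ` at level `M₁`; for each target index
`M* ≥ M₁` the walk at `I := M*` sheds the seed primes and returns a conductor of `r` engine primes of index `≥ M*` with `c_{M₁} ≠ 0`. -/
theorem deepSeedAtTwo_of_swap (hS : KolyvaginRoomSeedAtTwo) (hL : StartLineAtTwo) (hW : SeedPrimeSwapAtTwo) :
    Vertical.DeepSeedAtTwo := by
  intro W _ _ hCM hred hsurj K _ _ hK _ hH hodd hd3 htors hH2 Dt β ι hβ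
  haveI : ∀ k : ℕ, NumberField (ringClassField K ι k) :=
    Summit.BirchSwinnertonDyer.Rank1Residual.JET.numberField_ringClassField K hK ι
  obtain ⟨κ, B, hswap⟩ := hW W hCM hred hsurj K hK hH hodd hd3 htors hH2 Dt β ι hβ
  obtain ⟨r, hroom⟩ := hS W hCM hred hsurj K hK hH hodd hd3 htors hH2 Dt β ι hβ
  obtain ⟨n₁, d₁, M₁, hKol₁, hcard₁, hM₁, hidx₁, hvis₁⟩ := hroom (r * κ)
  refine ⟨r + B * r, M₁, hM₁, fun Mstar hMstar ↦ ?_⟩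
  have hstart := hL W hCM hred hsurj K hK hH hodd hd3 htors hH2 Dt β ι hβ M₁ hM₁
  have hv : n₁.primeFactors.card * κ ≤ r * κ := by rw [hcard₁]
  have hinv : n₁.primeFactors.card + B * n₁.primeFactors.card = r + B * r := by rw [hcard₁]
  obtain ⟨n', d', hKol', hcard', hidx', hc'⟩ :=
    walk W hM₁ hMstar (hswap) hstart n₁.primeFactors.card n₁ 1 (r * κ) n₁ d₁ (Nat.mul_one n₁).symm le_rfl hKol₁ hinv hidx₁
      (fun p hp ↦ by simp [Nat.primeFactors_one] at hp) (Or.inl rfl) hv hvis₁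
  exact ⟨n', d', hKol', hcard', hidx', hc'⟩

/-- COMPOSITION (kernel-checked, no sorry of its own): {S0ʳ, SW} + the tree's start line ⟹ DeepSeedAtTwo ⟹ U1 (v6 kernel `Vertical.*`);
concludes the ALIAS (gate skeleton rule: only `_of_stubs` below concludes the crux decl by name). -/
theorem boundedDefect_of (hS : KolyvaginRoomSeedAtTwo) (hW : SeedPrimeSwapAtTwo) : Vertical.CruxAlias :=
  Vertical.boundedDefect_of_deepSeed (deepSeedAtTwo_of_swap hS startLineAtTwo_holds hW)

/-- THE SKELETON THEOREM — the ONLY theorem in this file whose conclusion is the crux decl `KolyvaginBoundedDefectAtTwo` BY NAME; zero hypotheses;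
`sorry` enters only through the declared stubs `stub_*` (gate `#h21_check_skeleton` (i)–(iv)). -/
theorem KolyvaginBoundedDefectAtTwo_of_stubs : KolyvaginBoundedDefectAtTwo :=
  Vertical.cruxAlias_iff.mp (boundedDefect_of stub_roomSeedAtTwo seedPrimeSwapAtTwo_of_stubs)

end Summit.BirchSwinnertonDyer.BirchSwinnertonDyer.Cruxes.KolyvaginBoundedDefectAtTwo.KolyvaginSwap
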